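import Summits.Ventures.CertifiedManyBodySolver.Upper.IntervalReaderEmbedObsRows

/-!
# Ventures/CertifiedManyBodySolver — Upper/IntervalReaderEmbedObsClaimNode.lean: the nine- and eleven-conjunct W5
# nodes from the EMBED-layout bytes
(part 39 of the Theorem-H1′ package; parts 33–35 = the embed layout, 36–37 = the observable rows in the merge
layout, 38 = the `docc` / hopping windows from the embed bytes)

HONEST FRAMING: first certified bounds; not a superconductivity verdict; every number certified (two readers)
or labelled float.  Observable windows of one certified finite-box vector are certified variational statements about
ONE vector; never a sign of order, never an order-parameter word (LADDER v1.17 (i)).  This file is a DICTIONARY between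
two layouts of one reader; it certifies no number and moves no row.

**`producersSourcedBoxDiagHopNode_of_embedReader`**, **`producersSourcedBoxDoccDiagHopNode_of_embedReader`** — part
35's `producersSourcedBoxNode_of_embedReader` hypotheses (the `H̃`-, `Ñ`-, `Nrm`-sweeps over the dilated tables, the
ACCEPT / window tests by value, `n_lo > 0`, the F-V2 labels, the zero dummy slices) + the zero-field energy rows, the
(`docc`) rows and the `K₂` rows of the un-dilated witness `ψ̃ = undilate e′ (mpsOpenVar N A l r)` in the frame
`S′ = W·orbitalPhase g` — each supplied at the read point by ITS sweep's window (part 38's `doccWindow_of_embedReader` /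
`hoppingWindow_of_embedReader`; the zero-field rows by part 35's route or a derived one) ⟹ the NINE- / ELEVEN-conjunct
nodes, VERBATIM the conclusions of part 37 (ird-5's `sourcedBoxThreeRowNode_of_gaugedShibaWitness'` / part 36's
`sourcedBoxFourRowNode_of_gaugedShibaWitness'`): the bodies of `cert_sgf_openbox32x4_U8_mu7o4_k3o7_j264564_twoFieldDiagHop`
/ `…_twoFieldDoccDiagHop` up to `HasParity.mono`, from the bytes of the reads of record (ref-2c g29 precision P14).

Inputs outside the bytes, unchanged: the contractions (kit), the machine premises (A1)/(A2), the code tables =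
`quadAutomaton` over the dilated tables by value, the zero dummy slices, the by-value tests, the F-V2 labels, `n_lo > 0`.
-/

noncomputable section

-- The dilated orbital type `Orb (Orb Λ)` is a twice-nested `Lex` synonym (see part 35).
set_option synthInstance.maxSize 1024

open Matrix Finset WithLp
open scoped BigOperators ComplexOrder Matrix.Norms.L2Operator

namespace Summit.Ventures.CertifiedManyBodySolver.Upper.IntervalReader

open Literature.MathematicalPhysics.QuantumLattice
open Literature.MathematicalPhysics.QuantumLattice.JordanWigner
open Literature.MathematicalPhysics.QuantumLattice.JWEmbed
open Literature.MathematicalPhysics.QuantumLattice.TwoCluster (HasParity)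

/-! ## §P  The nine- and eleven-conjunct W5 nodes from the EMBED-layout bytes -/

section ObsNodes

variable {a b N D : ℕ}

/-- **THE NINE-CONJUNCT W5 NODE FROM THE EMBED LAYOUT, PRODUCERS' FRAME.**  Part 35's
`producersSourcedBoxNode_of_embedReader` hypotheses + the zero-field energy rows and the `K₂` rows of the un-dilated
witness (`hoppingWindow_of_embedReader` at `rectBoxDiagGraph a b`, `t = 1`).  Conclusion: part 37's nine conjuncts,
verbatim. -/
theorem producersSourcedBoxDiagHopNode_of_embedReader (U μ h : ℝ) (eQ nlo nhi e0lo e0hi k2lo k2hi : ℚ)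
    {g : Orb (Fin a ×ₗ Fin b) → ℂ} (hg : ∀ i, g i = 1 ∨ g i = -1) (e' : Fin N ≃ Orb (Fin a ×ₗ Fin b))
    (he' : ∀ i j, e' i < e' j ↔ i < j) (A : Fin N → MPSTensor 4 D) (hA2 : ∀ j, A j 2 = 0) (hA3 : ∀ j, A j 3 = 0)
    (l r : Fin D → ℂ) (κ : Fin N → ℝ) (hκ0 : ∀ k, 0 ≤ κ k)
    (hκ : ∀ k (z : EuclideanSpace ℂ (Fin D)), ∑ s, ‖toLp 2 (A k s *ᵥ ofLp z)‖ ^ 2 ≤ κ k * ‖z‖ ^ 2)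
    -- the `H̃`-sweep over the dilated automaton (producers' frame)
    (Mo : Fin N → QState N → QState N → ℝ) (hM0 : ∀ k b' c, 0 ≤ Mo k b' c)
    (hMrow : ∀ k b' c s, ∑ s', ‖quadAutomaton (dGammaHop (orbPullback e' (dilMatrix
      (Matrix.of fun i j => star (g i) * g j * w5Nambu a b μ h i j)))) (dilNN U e')
      (dilOnSite (Matrix.of fun i j => star (g i) * g j * w5Nambu a b μ h i j) U μ e') k b' c s s'‖ ≤ Mo k b' c)
    (hMcol : ∀ k b' c s', ∑ s, ‖quadAutomaton (dGammaHop (orbPullback e' (dilMatrix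
      (Matrix.of fun i j => star (g i) * g j * w5Nambu a b μ h i j)))) (dilNN U e')
      (dilOnSite (Matrix.of fun i j => star (g i) * g j * w5Nambu a b μ h i j) U μ e') k b' c s s'‖ ≤ Mo k b' c)
    (YH : Fin (N + 1) → QState N → Matrix (Fin D) (Fin D) ℂ) (ρH : Fin N → QState N → ℝ)
    (hρH : ∀ (k : Fin N) (c : QState N),
      ‖YH k.succ c - ∑ b', transferOp (A k) (quadAutomaton (dGammaHop (orbPullback e' (dilMatrix
      (Matrix.of fun i j => star (g i) * g j * w5Nambu a b μ h i j)))) (dilNN U e')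
      (dilOnSite (Matrix.of fun i j => star (g i) * g j * w5Nambu a b μ h i j) U μ e') k b' c) (YH k.castSucc b')‖ ≤ ρH k c)
    (radH : Fin (N + 1) → QState N → ℝ)
    (hrH0 : ∀ b', ‖YH 0 b' -
      (Pi.single QState.start (vecMulVec (star l) l) : QState N → Matrix (Fin D) (Fin D) ℂ) b'‖ ≤ radH 0 b')
    (hrH : ∀ (k : Fin N) (c : QState N), ∑ b', Mo k b' c * κ k * radH k.castSucc b' + ρH k c ≤ radH k.succ c)
    -- the `Ñ`-sweep
    (Mn : Fin N → QState N → QState N → ℝ) (hMn0 : ∀ k b' c, 0 ≤ Mn k b' c)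
    (hMnrow : ∀ k b' c s, ∑ s', ‖quadAutomaton (fun _ _ _ _ => 0) (fun _ _ _ _ => 0) (dilNumberOnSite a b e') k b' c s s'‖ ≤ Mn k b' c)
    (hMncol : ∀ k b' c s', ∑ s, ‖quadAutomaton (fun _ _ _ _ => 0) (fun _ _ _ _ => 0) (dilNumberOnSite a b e') k b' c s s'‖ ≤ Mn k b' c)
    (YD : Fin (N + 1) → QState N → Matrix (Fin D) (Fin D) ℂ) (ρD : Fin N → QState N → ℝ)
    (hρD : ∀ (k : Fin N) (c : QState N),
      ‖YD k.succ c - ∑ b', transferOp (A k) (quadAutomaton (fun _ _ _ _ => 0) (fun _ _ _ _ => 0) (dilNumberOnSite a b e') k b' c) (YD k.castSucc b')‖ ≤ ρD k c)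
    (radD : Fin (N + 1) → QState N → ℝ)
    (hrD0 : ∀ b', ‖YD 0 b' -
      (Pi.single QState.start (vecMulVec (star l) l) : QState N → Matrix (Fin D) (Fin D) ℂ) b'‖ ≤ radD 0 b')
    (hrD : ∀ (k : Fin N) (c : QState N), ∑ b', Mn k b' c * κ k * radD k.castSucc b' + ρD k c ≤ radD k.succ c)
    -- the `Nrm`-sweep (shared)
    (YN : Fin (N + 1) → Matrix (Fin D) (Fin D) ℂ) (ρN : Fin N → ℝ)
    (hρN : ∀ k : Fin N, ‖YN k.succ - transferOp (A k) 1 (YN k.castSucc)‖ ≤ ρN k)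
    (radN : Fin (N + 1) → ℝ) (hrN0 : ‖YN 0 - vecMulVec (star l) l‖ ≤ radN 0)
    (hrN : ∀ k : Fin N, 1 * κ k * radN k.castSucc + ρN k ≤ radN k.succ)
    -- the by-value ACCEPT test of the energy row against `E = e·ab`
    (hElo : (star r ⬝ᵥ (YH (Fin.last N) QState.fin *ᵥ r)).re +
        (∑ i, ‖r i‖) * (∑ i, ‖r i‖) * radH (Fin.last N) QState.fin ≤
      ((eQ : ℝ) * ((a : ℝ) * b)) * ((star r ⬝ᵥ (YN (Fin.last N) *ᵥ r)).re - (∑ i, ‖r i‖) * (∑ i, ‖r i‖) * radN (Fin.last N)))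
    (hEhi : (star r ⬝ᵥ (YH (Fin.last N) QState.fin *ᵥ r)).re +
        (∑ i, ‖r i‖) * (∑ i, ‖r i‖) * radH (Fin.last N) QState.fin ≤
      ((eQ : ℝ) * ((a : ℝ) * b)) * ((star r ⬝ᵥ (YN (Fin.last N) *ᵥ r)).re + (∑ i, ‖r i‖) * (∑ i, ‖r i‖) * radN (Fin.last N)))
    -- the four by-value window tests of the density row against `n_lo·ab`, `n_hi·ab`
    (hnlo1 : ((nlo : ℝ) * ((a : ℝ) * b)) * ((star r ⬝ᵥ (YN (Fin.last N) *ᵥ r)).re - (∑ i, ‖r i‖) * (∑ i, ‖r i‖) * radN (Fin.last N)) ≤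
      (star r ⬝ᵥ (YD (Fin.last N) QState.fin *ᵥ r)).re - (∑ i, ‖r i‖) * (∑ i, ‖r i‖) * radD (Fin.last N) QState.fin)
    (hnlo2 : ((nlo : ℝ) * ((a : ℝ) * b)) * ((star r ⬝ᵥ (YN (Fin.last N) *ᵥ r)).re + (∑ i, ‖r i‖) * (∑ i, ‖r i‖) * radN (Fin.last N)) ≤
      (star r ⬝ᵥ (YD (Fin.last N) QState.fin *ᵥ r)).re - (∑ i, ‖r i‖) * (∑ i, ‖r i‖) * radD (Fin.last N) QState.fin)
    (hnhi1 : (star r ⬝ᵥ (YD (Fin.last N) QState.fin *ᵥ r)).re +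
        (∑ i, ‖r i‖) * (∑ i, ‖r i‖) * radD (Fin.last N) QState.fin ≤
      ((nhi : ℝ) * ((a : ℝ) * b)) * ((star r ⬝ᵥ (YN (Fin.last N) *ᵥ r)).re - (∑ i, ‖r i‖) * (∑ i, ‖r i‖) * radN (Fin.last N)))
    (hnhi2 : (star r ⬝ᵥ (YD (Fin.last N) QState.fin *ᵥ r)).re +
        (∑ i, ‖r i‖) * (∑ i, ‖r i‖) * radD (Fin.last N) QState.fin ≤
      ((nhi : ℝ) * ((a : ℝ) * b)) * ((star r ⬝ᵥ (YN (Fin.last N) *ᵥ r)).re + (∑ i, ‖r i‖) * (∑ i, ‖r i‖) * radN (Fin.last N)))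
    -- the code's assertion `n_lo > 0` (h1sweep.py l.398) and the certificate's F-V2 labels (right label `Ñ`)
    (hn : (∑ i, ‖r i‖) * (∑ i, ‖r i‖) * radN (Fin.last N) < (star r ⬝ᵥ (YN (Fin.last N) *ᵥ r)).re)
    (Nt : ℕ) (c : Fin (N + 1) → Fin D → ℕ)
    (hcl : ∀ α, l α ≠ 0 → c 0 α = 0) (hcr : ∀ β, r β ≠ 0 → c (Fin.last N) β = Nt)
    (hcA : ∀ (j : Fin N) (s : Fin 4) (α β : Fin D), A j s α β ≠ 0 → c j.succ β = c j.castSucc α + siteCharge s)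
    -- the zero-field energy rows and the `K₂` rows of the un-dilated witness (its own sweeps' windows)
    (h0lo : ((e0lo : ℝ) * ((a : ℝ) * b)) * (star (undilate e' (mpsOpenVar N A l r)) ⬝ᵥ undilate e' (mpsOpenVar N A l r)).re ≤
      (star (undilate e' (mpsOpenVar N A l r)) ⬝ᵥ
        (((partialParticleHole (spinDownOrbitals : Finset (Orb (Fin a ×ₗ Fin b))) * orbitalPhase g)ᴴ *
            dWaveSourceOpenBox a b U μ 0 * (partialParticleHole (spinDownOrbitals : Finset (Orb (Fin a ×ₗ Fin b))) * orbitalPhase g)) *ᵥ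
          undilate e' (mpsOpenVar N A l r))).re)
    (h0hi : (star (undilate e' (mpsOpenVar N A l r)) ⬝ᵥ
        (((partialParticleHole (spinDownOrbitals : Finset (Orb (Fin a ×ₗ Fin b))) * orbitalPhase g)ᴴ *
            dWaveSourceOpenBox a b U μ 0 * (partialParticleHole (spinDownOrbitals : Finset (Orb (Fin a ×ₗ Fin b))) * orbitalPhase g)) *ᵥ
          undilate e' (mpsOpenVar N A l r))).re ≤
      ((e0hi : ℝ) * ((a : ℝ) * b)) * (star (undilate e' (mpsOpenVar N A l r)) ⬝ᵥ undilate e' (mpsOpenVar N A l r)).re)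
    (hklo : ((k2lo : ℝ) * ((a : ℝ) * b)) * (star (undilate e' (mpsOpenVar N A l r)) ⬝ᵥ undilate e' (mpsOpenVar N A l r)).re ≤
      (star (undilate e' (mpsOpenVar N A l r)) ⬝ᵥ
        (((partialParticleHole (spinDownOrbitals : Finset (Orb (Fin a ×ₗ Fin b))) * orbitalPhase g)ᴴ *
            hamiltonian (rectBoxDiagGraph a b) 1 0 * (partialParticleHole (spinDownOrbitals : Finset (Orb (Fin a ×ₗ Fin b))) * orbitalPhase g)) *ᵥ
          undilate e' (mpsOpenVar N A l r))).re)
    (hkhi : (star (undilate e' (mpsOpenVar N A l r)) ⬝ᵥ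
        (((partialParticleHole (spinDownOrbitals : Finset (Orb (Fin a ×ₗ Fin b))) * orbitalPhase g)ᴴ *
            hamiltonian (rectBoxDiagGraph a b) 1 0 * (partialParticleHole (spinDownOrbitals : Finset (Orb (Fin a ×ₗ Fin b))) * orbitalPhase g)) *ᵥ
          undilate e' (mpsOpenVar N A l r))).re ≤
      ((k2hi : ℝ) * ((a : ℝ) * b)) * (star (undilate e' (mpsOpenVar N A l r)) ⬝ᵥ undilate e' (mpsOpenVar N A l r)).re) :
    ∃ ψ : Fock (Orb (Fin a ×ₗ Fin b)), HasParity (Nt + a * b) ψ ∧ star ψ ⬝ᵥ ψ = 1 ∧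
      (star ψ ⬝ᵥ (dWaveSourceOpenBox a b U μ h *ᵥ ψ)).re ≤ ((eQ : ℚ) : ℝ) * ((a : ℝ) * b) ∧
      ((nlo : ℚ) : ℝ) * ((a : ℝ) * b) ≤ (star ψ ⬝ᵥ (totalNumber *ᵥ ψ)).re ∧
      (star ψ ⬝ᵥ (totalNumber *ᵥ ψ)).re ≤ ((nhi : ℚ) : ℝ) * ((a : ℝ) * b) ∧
      ((e0lo : ℚ) : ℝ) * ((a : ℝ) * b) ≤ (star ψ ⬝ᵥ (dWaveSourceOpenBox a b U μ 0 *ᵥ ψ)).re ∧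
      (star ψ ⬝ᵥ (dWaveSourceOpenBox a b U μ 0 *ᵥ ψ)).re ≤ ((e0hi : ℚ) : ℝ) * ((a : ℝ) * b) ∧
      ((k2lo : ℚ) : ℝ) * ((a : ℝ) * b) ≤ (star ψ ⬝ᵥ (hamiltonian (rectBoxDiagGraph a b) 1 0 *ᵥ ψ)).re ∧
      (star ψ ⬝ᵥ (hamiltonian (rectBoxDiagGraph a b) 1 0 *ᵥ ψ)).re ≤ ((k2hi : ℚ) : ℝ) * ((a : ℝ) * b) := by
  have hg' : ∀ i, ‖g i‖ = 1 := fun i => by rcases hg i with h1 | h1 <;> simp [h1]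
  have hsupp := mpsOpenVar_eq_zero_of_dummy A l r hA2 hA3
  -- the energy row on the chain, then un-dilated (as in part 35)
  have hEc := wordSum_sentence_of_reader _ _ _ A l r κ hκ0 hκ Mo hM0 hMrow hMcol YH ρH hρH radH hrH0 hrH YN ρN hρN radN
    hrN0 hrN ((eQ : ℝ) * ((a : ℝ) * b)) hElo hEhi
  have hE : (star (undilate e' (mpsOpenVar N A l r)) ⬝ᵥ
      (((partialParticleHole (spinDownOrbitals : Finset (Orb (Fin a ×ₗ Fin b))) * orbitalPhase g)ᴴ *
          dWaveSourceOpenBox a b U μ h *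
          (partialParticleHole (spinDownOrbitals : Finset (Orb (Fin a ×ₗ Fin b))) * orbitalPhase g)) *ᵥ
        undilate e' (mpsOpenVar N A l r))).re ≤
      (eQ : ℝ) * ((a : ℝ) * b) * (star (undilate e' (mpsOpenVar N A l r)) ⬝ᵥ undilate e' (mpsOpenVar N A l r)).re := by
    rw [gaugedShiba'_conjTranspose_conj_dWaveSourceOpenBox (a := a) (b := b) U μ h hg',
      undilate_sandwich e' _ hsupp, jwEmbed_dilOrb_quadratic,
      inner_dilQuadratic_eq_quadWordSum _ (gaugedNambu_symm_of_sign μ h hg) U μ e' he', undilate_norm e' _ hsupp]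
    exact hEc
  -- the density window on the chain, then un-dilated
  have hDc := wordSum_window_of_reader _ _ _ A l r κ hκ0 hκ Mn hMn0 hMnrow hMncol YD ρD hρD radD hrD0 hrD YN ρN hρN radN
    hrN0 hrN ((nlo : ℝ) * ((a : ℝ) * b)) ((nhi : ℝ) * ((a : ℝ) * b)) hnlo1 hnlo2 hnhi1 hnhi2
  have hDW : (nlo : ℝ) * ((a : ℝ) * b) * (star (undilate e' (mpsOpenVar N A l r)) ⬝ᵥ undilate e' (mpsOpenVar N A l r)).re ≤
      (star (undilate e' (mpsOpenVar N A l r)) ⬝ᵥ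
        (((partialParticleHole (spinDownOrbitals : Finset (Orb (Fin a ×ₗ Fin b))) * orbitalPhase g)ᴴ * totalNumber *
            (partialParticleHole (spinDownOrbitals : Finset (Orb (Fin a ×ₗ Fin b))) * orbitalPhase g)) *ᵥ
          undilate e' (mpsOpenVar N A l r))).re ∧
      (star (undilate e' (mpsOpenVar N A l r)) ⬝ᵥ
        (((partialParticleHole (spinDownOrbitals : Finset (Orb (Fin a ×ₗ Fin b))) * orbitalPhase g)ᴴ * totalNumber *
            (partialParticleHole (spinDownOrbitals : Finset (Orb (Fin a ×ₗ Fin b))) * orbitalPhase g)) *ᵥ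
          undilate e' (mpsOpenVar N A l r))).re ≤
      (nhi : ℝ) * ((a : ℝ) * b) * (star (undilate e' (mpsOpenVar N A l r)) ⬝ᵥ undilate e' (mpsOpenVar N A l r)).re := by
    rw [gaugedShiba'_conjTranspose_conj_totalNumber hg', undilate_sandwich e' _ hsupp, jwEmbed_dilOrb_number,
      inner_dilNumber_eq_quadWordSum e', undilate_norm e' _ hsupp]
    exact hDc
  -- V1 and V3, un-dilated
  have hN : IsNParticle Nt (undilate e' (mpsOpenVar N A l r)) := by
    apply isNParticle_undilate
    rw [isNParticle_iff, LinearEquiv.apply_symm_apply]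
    exact mpsOpenVar_relabel_eq_zero_of_charge e' A l r Nt c hcl hcr hcA
  have hpos : 0 < (star (undilate e' (mpsOpenVar N A l r)) ⬝ᵥ undilate e' (mpsOpenVar N A l r)).re := by
    rw [undilate_norm e' _ hsupp, ← star_compEquiv_dotProduct e']
    exact re_pos_of_window (norm_window_of_reader e' A l r κ hκ0 hκ YN ρN hρN radN hrN0 hrN) hn
  exact sourcedBoxThreeRowNode_of_gaugedShibaWitness' a b U μ h eQ nlo nhi e0lo e0hi k2lo k2hi hg' _ hN hpos hE
    hDW.1 hDW.2 h0lo h0hi hklo hkhi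

/-- **THE ELEVEN-CONJUNCT W5 NODE FROM THE EMBED LAYOUT, PRODUCERS' FRAME.**  The same + the `docc` rows of the
un-dilated witness (`doccWindow_of_embedReader`), x2dk order.  Conclusion: part 37's eleven conjuncts, verbatim — the
body of `cert_sgf_openbox32x4_U8_mu7o4_k3o7_j264564_twoFieldDoccDiagHop` up to `HasParity.mono`, from the bytes of
the reads of record (embed layout). -/
theorem producersSourcedBoxDoccDiagHopNode_of_embedReader (U μ h : ℝ) (eQ nlo nhi e0lo e0hi dlo dhi k2lo k2hi : ℚ)
    {g : Orb (Fin a ×ₗ Fin b) → ℂ} (hg : ∀ i, g i = 1 ∨ g i = -1) (e' : Fin N ≃ Orb (Fin a ×ₗ Fin b))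
    (he' : ∀ i j, e' i < e' j ↔ i < j) (A : Fin N → MPSTensor 4 D) (hA2 : ∀ j, A j 2 = 0) (hA3 : ∀ j, A j 3 = 0)
    (l r : Fin D → ℂ) (κ : Fin N → ℝ) (hκ0 : ∀ k, 0 ≤ κ k)
    (hκ : ∀ k (z : EuclideanSpace ℂ (Fin D)), ∑ s, ‖toLp 2 (A k s *ᵥ ofLp z)‖ ^ 2 ≤ κ k * ‖z‖ ^ 2)
    -- the `H̃`-sweep over the dilated automaton (producers' frame)
    (Mo : Fin N → QState N → QState N → ℝ) (hM0 : ∀ k b' c, 0 ≤ Mo k b' c)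
    (hMrow : ∀ k b' c s, ∑ s', ‖quadAutomaton (dGammaHop (orbPullback e' (dilMatrix
      (Matrix.of fun i j => star (g i) * g j * w5Nambu a b μ h i j)))) (dilNN U e')
      (dilOnSite (Matrix.of fun i j => star (g i) * g j * w5Nambu a b μ h i j) U μ e') k b' c s s'‖ ≤ Mo k b' c)
    (hMcol : ∀ k b' c s', ∑ s, ‖quadAutomaton (dGammaHop (orbPullback e' (dilMatrix
      (Matrix.of fun i j => star (g i) * g j * w5Nambu a b μ h i j)))) (dilNN U e')
      (dilOnSite (Matrix.of fun i j => star (g i) * g j * w5Nambu a b μ h i j) U μ e') k b' c s s'‖ ≤ Mo k b' c)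
    (YH : Fin (N + 1) → QState N → Matrix (Fin D) (Fin D) ℂ) (ρH : Fin N → QState N → ℝ)
    (hρH : ∀ (k : Fin N) (c : QState N),
      ‖YH k.succ c - ∑ b', transferOp (A k) (quadAutomaton (dGammaHop (orbPullback e' (dilMatrix
      (Matrix.of fun i j => star (g i) * g j * w5Nambu a b μ h i j)))) (dilNN U e')
      (dilOnSite (Matrix.of fun i j => star (g i) * g j * w5Nambu a b μ h i j) U μ e') k b' c) (YH k.castSucc b')‖ ≤ ρH k c)
    (radH : Fin (N + 1) → QState N → ℝ)
    (hrH0 : ∀ b', ‖YH 0 b' -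
      (Pi.single QState.start (vecMulVec (star l) l) : QState N → Matrix (Fin D) (Fin D) ℂ) b'‖ ≤ radH 0 b')
    (hrH : ∀ (k : Fin N) (c : QState N), ∑ b', Mo k b' c * κ k * radH k.castSucc b' + ρH k c ≤ radH k.succ c)
    -- the `Ñ`-sweep
    (Mn : Fin N → QState N → QState N → ℝ) (hMn0 : ∀ k b' c, 0 ≤ Mn k b' c)
    (hMnrow : ∀ k b' c s, ∑ s', ‖quadAutomaton (fun _ _ _ _ => 0) (fun _ _ _ _ => 0) (dilNumberOnSite a b e') k b' c s s'‖ ≤ Mn k b' c)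
    (hMncol : ∀ k b' c s', ∑ s, ‖quadAutomaton (fun _ _ _ _ => 0) (fun _ _ _ _ => 0) (dilNumberOnSite a b e') k b' c s s'‖ ≤ Mn k b' c)
    (YD : Fin (N + 1) → QState N → Matrix (Fin D) (Fin D) ℂ) (ρD : Fin N → QState N → ℝ)
    (hρD : ∀ (k : Fin N) (c : QState N),
      ‖YD k.succ c - ∑ b', transferOp (A k) (quadAutomaton (fun _ _ _ _ => 0) (fun _ _ _ _ => 0) (dilNumberOnSite a b e') k b' c) (YD k.castSucc b')‖ ≤ ρD k c)
    (radD : Fin (N + 1) → QState N → ℝ)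
    (hrD0 : ∀ b', ‖YD 0 b' -
      (Pi.single QState.start (vecMulVec (star l) l) : QState N → Matrix (Fin D) (Fin D) ℂ) b'‖ ≤ radD 0 b')
    (hrD : ∀ (k : Fin N) (c : QState N), ∑ b', Mn k b' c * κ k * radD k.castSucc b' + ρD k c ≤ radD k.succ c)
    -- the `Nrm`-sweep (shared)
    (YN : Fin (N + 1) → Matrix (Fin D) (Fin D) ℂ) (ρN : Fin N → ℝ)
    (hρN : ∀ k : Fin N, ‖YN k.succ - transferOp (A k) 1 (YN k.castSucc)‖ ≤ ρN k)
    (radN : Fin (N + 1) → ℝ) (hrN0 : ‖YN 0 - vecMulVec (star l) l‖ ≤ radN 0)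
    (hrN : ∀ k : Fin N, 1 * κ k * radN k.castSucc + ρN k ≤ radN k.succ)
    -- the by-value ACCEPT test of the energy row against `E = e·ab`
    (hElo : (star r ⬝ᵥ (YH (Fin.last N) QState.fin *ᵥ r)).re +
        (∑ i, ‖r i‖) * (∑ i, ‖r i‖) * radH (Fin.last N) QState.fin ≤
      ((eQ : ℝ) * ((a : ℝ) * b)) * ((star r ⬝ᵥ (YN (Fin.last N) *ᵥ r)).re - (∑ i, ‖r i‖) * (∑ i, ‖r i‖) * radN (Fin.last N)))
    (hEhi : (star r ⬝ᵥ (YH (Fin.last N) QState.fin *ᵥ r)).re +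
        (∑ i, ‖r i‖) * (∑ i, ‖r i‖) * radH (Fin.last N) QState.fin ≤
      ((eQ : ℝ) * ((a : ℝ) * b)) * ((star r ⬝ᵥ (YN (Fin.last N) *ᵥ r)).re + (∑ i, ‖r i‖) * (∑ i, ‖r i‖) * radN (Fin.last N)))
    -- the four by-value window tests of the density row against `n_lo·ab`, `n_hi·ab`
    (hnlo1 : ((nlo : ℝ) * ((a : ℝ) * b)) * ((star r ⬝ᵥ (YN (Fin.last N) *ᵥ r)).re - (∑ i, ‖r i‖) * (∑ i, ‖r i‖) * radN (Fin.last N)) ≤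
      (star r ⬝ᵥ (YD (Fin.last N) QState.fin *ᵥ r)).re - (∑ i, ‖r i‖) * (∑ i, ‖r i‖) * radD (Fin.last N) QState.fin)
    (hnlo2 : ((nlo : ℝ) * ((a : ℝ) * b)) * ((star r ⬝ᵥ (YN (Fin.last N) *ᵥ r)).re + (∑ i, ‖r i‖) * (∑ i, ‖r i‖) * radN (Fin.last N)) ≤
      (star r ⬝ᵥ (YD (Fin.last N) QState.fin *ᵥ r)).re - (∑ i, ‖r i‖) * (∑ i, ‖r i‖) * radD (Fin.last N) QState.fin)
    (hnhi1 : (star r ⬝ᵥ (YD (Fin.last N) QState.fin *ᵥ r)).re +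
        (∑ i, ‖r i‖) * (∑ i, ‖r i‖) * radD (Fin.last N) QState.fin ≤
      ((nhi : ℝ) * ((a : ℝ) * b)) * ((star r ⬝ᵥ (YN (Fin.last N) *ᵥ r)).re - (∑ i, ‖r i‖) * (∑ i, ‖r i‖) * radN (Fin.last N)))
    (hnhi2 : (star r ⬝ᵥ (YD (Fin.last N) QState.fin *ᵥ r)).re +
        (∑ i, ‖r i‖) * (∑ i, ‖r i‖) * radD (Fin.last N) QState.fin ≤
      ((nhi : ℝ) * ((a : ℝ) * b)) * ((star r ⬝ᵥ (YN (Fin.last N) *ᵥ r)).re + (∑ i, ‖r i‖) * (∑ i, ‖r i‖) * radN (Fin.last N)))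
    -- the code's assertion `n_lo > 0` (h1sweep.py l.398) and the certificate's F-V2 labels (right label `Ñ`)
    (hn : (∑ i, ‖r i‖) * (∑ i, ‖r i‖) * radN (Fin.last N) < (star r ⬝ᵥ (YN (Fin.last N) *ᵥ r)).re)
    (Nt : ℕ) (c : Fin (N + 1) → Fin D → ℕ)
    (hcl : ∀ α, l α ≠ 0 → c 0 α = 0) (hcr : ∀ β, r β ≠ 0 → c (Fin.last N) β = Nt)
    (hcA : ∀ (j : Fin N) (s : Fin 4) (α β : Fin D), A j s α β ≠ 0 → c j.succ β = c j.castSucc α + siteCharge s)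
    -- the zero-field energy, `docc` and `K₂` rows of the un-dilated witness (its own sweeps' windows)
    (h0lo : ((e0lo : ℝ) * ((a : ℝ) * b)) * (star (undilate e' (mpsOpenVar N A l r)) ⬝ᵥ undilate e' (mpsOpenVar N A l r)).re ≤
      (star (undilate e' (mpsOpenVar N A l r)) ⬝ᵥ
        (((partialParticleHole (spinDownOrbitals : Finset (Orb (Fin a ×ₗ Fin b))) * orbitalPhase g)ᴴ *
            dWaveSourceOpenBox a b U μ 0 * (partialParticleHole (spinDownOrbitals : Finset (Orb (Fin a ×ₗ Fin b))) * orbitalPhase g)) *ᵥ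
          undilate e' (mpsOpenVar N A l r))).re)
    (h0hi : (star (undilate e' (mpsOpenVar N A l r)) ⬝ᵥ
        (((partialParticleHole (spinDownOrbitals : Finset (Orb (Fin a ×ₗ Fin b))) * orbitalPhase g)ᴴ *
            dWaveSourceOpenBox a b U μ 0 * (partialParticleHole (spinDownOrbitals : Finset (Orb (Fin a ×ₗ Fin b))) * orbitalPhase g)) *ᵥ
          undilate e' (mpsOpenVar N A l r))).re ≤
      ((e0hi : ℝ) * ((a : ℝ) * b)) * (star (undilate e' (mpsOpenVar N A l r)) ⬝ᵥ undilate e' (mpsOpenVar N A l r)).re)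
    (hdlo : ((dlo : ℝ) * ((a : ℝ) * b)) * (star (undilate e' (mpsOpenVar N A l r)) ⬝ᵥ undilate e' (mpsOpenVar N A l r)).re ≤
      (star (undilate e' (mpsOpenVar N A l r)) ⬝ᵥ
        (((partialParticleHole (spinDownOrbitals : Finset (Orb (Fin a ×ₗ Fin b))) * orbitalPhase g)ᴴ *
            (∑ x : Fin a ×ₗ Fin b, numberOp x 0 * numberOp x 1) * (partialParticleHole (spinDownOrbitals : Finset (Orb (Fin a ×ₗ Fin b))) * orbitalPhase g)) *ᵥ
          undilate e' (mpsOpenVar N A l r))).re)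
    (hdhi : (star (undilate e' (mpsOpenVar N A l r)) ⬝ᵥ
        (((partialParticleHole (spinDownOrbitals : Finset (Orb (Fin a ×ₗ Fin b))) * orbitalPhase g)ᴴ *
            (∑ x : Fin a ×ₗ Fin b, numberOp x 0 * numberOp x 1) * (partialParticleHole (spinDownOrbitals : Finset (Orb (Fin a ×ₗ Fin b))) * orbitalPhase g)) *ᵥ
          undilate e' (mpsOpenVar N A l r))).re ≤
      ((dhi : ℝ) * ((a : ℝ) * b)) * (star (undilate e' (mpsOpenVar N A l r)) ⬝ᵥ undilate e' (mpsOpenVar N A l r)).re)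
    (hklo : ((k2lo : ℝ) * ((a : ℝ) * b)) * (star (undilate e' (mpsOpenVar N A l r)) ⬝ᵥ undilate e' (mpsOpenVar N A l r)).re ≤
      (star (undilate e' (mpsOpenVar N A l r)) ⬝ᵥ
        (((partialParticleHole (spinDownOrbitals : Finset (Orb (Fin a ×ₗ Fin b))) * orbitalPhase g)ᴴ *
            hamiltonian (rectBoxDiagGraph a b) 1 0 * (partialParticleHole (spinDownOrbitals : Finset (Orb (Fin a ×ₗ Fin b))) * orbitalPhase g)) *ᵥ
          undilate e' (mpsOpenVar N A l r))).re)
    (hkhi : (star (undilate e' (mpsOpenVar N A l r)) ⬝ᵥ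
        (((partialParticleHole (spinDownOrbitals : Finset (Orb (Fin a ×ₗ Fin b))) * orbitalPhase g)ᴴ *
            hamiltonian (rectBoxDiagGraph a b) 1 0 * (partialParticleHole (spinDownOrbitals : Finset (Orb (Fin a ×ₗ Fin b))) * orbitalPhase g)) *ᵥ
          undilate e' (mpsOpenVar N A l r))).re ≤
      ((k2hi : ℝ) * ((a : ℝ) * b)) * (star (undilate e' (mpsOpenVar N A l r)) ⬝ᵥ undilate e' (mpsOpenVar N A l r)).re) :
    ∃ ψ : Fock (Orb (Fin a ×ₗ Fin b)), HasParity (Nt + a * b) ψ ∧ star ψ ⬝ᵥ ψ = 1 ∧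
      (star ψ ⬝ᵥ (dWaveSourceOpenBox a b U μ h *ᵥ ψ)).re ≤ ((eQ : ℚ) : ℝ) * ((a : ℝ) * b) ∧
      ((nlo : ℚ) : ℝ) * ((a : ℝ) * b) ≤ (star ψ ⬝ᵥ (totalNumber *ᵥ ψ)).re ∧
      (star ψ ⬝ᵥ (totalNumber *ᵥ ψ)).re ≤ ((nhi : ℚ) : ℝ) * ((a : ℝ) * b) ∧
      ((e0lo : ℚ) : ℝ) * ((a : ℝ) * b) ≤ (star ψ ⬝ᵥ (dWaveSourceOpenBox a b U μ 0 *ᵥ ψ)).re ∧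
      (star ψ ⬝ᵥ (dWaveSourceOpenBox a b U μ 0 *ᵥ ψ)).re ≤ ((e0hi : ℚ) : ℝ) * ((a : ℝ) * b) ∧
      ((dlo : ℚ) : ℝ) * ((a : ℝ) * b) ≤
        (star ψ ⬝ᵥ ((∑ x : Fin a ×ₗ Fin b, numberOp x 0 * numberOp x 1) *ᵥ ψ)).re ∧
      (star ψ ⬝ᵥ ((∑ x : Fin a ×ₗ Fin b, numberOp x 0 * numberOp x 1) *ᵥ ψ)).re ≤
        ((dhi : ℚ) : ℝ) * ((a : ℝ) * b) ∧
      ((k2lo : ℚ) : ℝ) * ((a : ℝ) * b) ≤ (star ψ ⬝ᵥ (hamiltonian (rectBoxDiagGraph a b) 1 0 *ᵥ ψ)).re ∧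
      (star ψ ⬝ᵥ (hamiltonian (rectBoxDiagGraph a b) 1 0 *ᵥ ψ)).re ≤ ((k2hi : ℚ) : ℝ) * ((a : ℝ) * b) := by
  have hg' : ∀ i, ‖g i‖ = 1 := fun i => by rcases hg i with h1 | h1 <;> simp [h1]
  have hsupp := mpsOpenVar_eq_zero_of_dummy A l r hA2 hA3
  -- the energy row on the chain, then un-dilated (as in part 35)
  have hEc := wordSum_sentence_of_reader _ _ _ A l r κ hκ0 hκ Mo hM0 hMrow hMcol YH ρH hρH radH hrH0 hrH YN ρN hρN radN
    hrN0 hrN ((eQ : ℝ) * ((a : ℝ) * b)) hElo hEhi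
  have hE : (star (undilate e' (mpsOpenVar N A l r)) ⬝ᵥ
      (((partialParticleHole (spinDownOrbitals : Finset (Orb (Fin a ×ₗ Fin b))) * orbitalPhase g)ᴴ *
          dWaveSourceOpenBox a b U μ h *
          (partialParticleHole (spinDownOrbitals : Finset (Orb (Fin a ×ₗ Fin b))) * orbitalPhase g)) *ᵥ
        undilate e' (mpsOpenVar N A l r))).re ≤
      (eQ : ℝ) * ((a : ℝ) * b) * (star (undilate e' (mpsOpenVar N A l r)) ⬝ᵥ undilate e' (mpsOpenVar N A l r)).re := by
    rw [gaugedShiba'_conjTranspose_conj_dWaveSourceOpenBox (a := a) (b := b) U μ h hg',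
      undilate_sandwich e' _ hsupp, jwEmbed_dilOrb_quadratic,
      inner_dilQuadratic_eq_quadWordSum _ (gaugedNambu_symm_of_sign μ h hg) U μ e' he', undilate_norm e' _ hsupp]
    exact hEc
  -- the density window on the chain, then un-dilated
  have hDc := wordSum_window_of_reader _ _ _ A l r κ hκ0 hκ Mn hMn0 hMnrow hMncol YD ρD hρD radD hrD0 hrD YN ρN hρN radN
    hrN0 hrN ((nlo : ℝ) * ((a : ℝ) * b)) ((nhi : ℝ) * ((a : ℝ) * b)) hnlo1 hnlo2 hnhi1 hnhi2
  have hDW : (nlo : ℝ) * ((a : ℝ) * b) * (star (undilate e' (mpsOpenVar N A l r)) ⬝ᵥ undilate e' (mpsOpenVar N A l r)).re ≤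
      (star (undilate e' (mpsOpenVar N A l r)) ⬝ᵥ
        (((partialParticleHole (spinDownOrbitals : Finset (Orb (Fin a ×ₗ Fin b))) * orbitalPhase g)ᴴ * totalNumber *
            (partialParticleHole (spinDownOrbitals : Finset (Orb (Fin a ×ₗ Fin b))) * orbitalPhase g)) *ᵥ
          undilate e' (mpsOpenVar N A l r))).re ∧
      (star (undilate e' (mpsOpenVar N A l r)) ⬝ᵥ
        (((partialParticleHole (spinDownOrbitals : Finset (Orb (Fin a ×ₗ Fin b))) * orbitalPhase g)ᴴ * totalNumber *
            (partialParticleHole (spinDownOrbitals : Finset (Orb (Fin a ×ₗ Fin b))) * orbitalPhase g)) *ᵥ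
          undilate e' (mpsOpenVar N A l r))).re ≤
      (nhi : ℝ) * ((a : ℝ) * b) * (star (undilate e' (mpsOpenVar N A l r)) ⬝ᵥ undilate e' (mpsOpenVar N A l r)).re := by
    rw [gaugedShiba'_conjTranspose_conj_totalNumber hg', undilate_sandwich e' _ hsupp, jwEmbed_dilOrb_number,
      inner_dilNumber_eq_quadWordSum e', undilate_norm e' _ hsupp]
    exact hDc
  -- V1 and V3, un-dilated
  have hN : IsNParticle Nt (undilate e' (mpsOpenVar N A l r)) := by
    apply isNParticle_undilate
    rw [isNParticle_iff, LinearEquiv.apply_symm_apply]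
    exact mpsOpenVar_relabel_eq_zero_of_charge e' A l r Nt c hcl hcr hcA
  have hpos : 0 < (star (undilate e' (mpsOpenVar N A l r)) ⬝ᵥ undilate e' (mpsOpenVar N A l r)).re := by
    rw [undilate_norm e' _ hsupp, ← star_compEquiv_dotProduct e']
    exact re_pos_of_window (norm_window_of_reader e' A l r κ hκ0 hκ YN ρN hρN radN hrN0 hrN) hn
  exact sourcedBoxFourRowNode_of_gaugedShibaWitness' a b U μ h eQ nlo nhi e0lo e0hi dlo dhi k2lo k2hi hg' _ hN
    hpos hE hDW.1 hDW.2 h0lo h0hi hdlo hdhi hklo hkhi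

end ObsNodes

end Summit.Ventures.CertifiedManyBodySolver.Upper.IntervalReader

end
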